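import Mathlib
import HarnessLib
import Summits.RiemannHypothesis.RiemannHypothesis.Theses.WeilParity
import Summits.RiemannHypothesis.RiemannHypothesis.Theorems.WeilParityEvenWinsBeyondArchSplit

/-!
# Route WeilParity: the split glue of crux #3 as a route item

`EvenWinsBeyondArchOfPieces` (item stmt-RiemannHypothesis-17975):
`OnePrimeWindowSimpleEven → NoParityCrossing → EvenWinsBeyondArch` — the two filed pieces of the crux
`EvenWinsBeyondArch` (the RH-free one-prime window, item 18084, and the RH-bearing "no parity
level-crossing beyond (log 3)/2", item 18085) imply it.  One line over the landed glue
`Theorems.EvenWinsBeyondArch.evenWinsBeyondArch_of_subs` (`WeilParityEvenWinsBeyondArchSplit.lean`,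
p148526: strict order on the one-prime window from the Connes–van Suijlekom clause, IVT propagation
beyond the anchor `(log 3)/2` by the landed RH-free sector continuity, no tie, then the junk-free
conversion).  Axioms: propext, Classical.choice, Quot.sound.
-/

namespace Summit.RiemannHypothesis.RiemannHypothesis.Theorems.WeilParity

/-- **Item stmt-RiemannHypothesis-17975** (`EvenWinsBeyondArchOfPieces`): the one-prime parity theorem
and "no parity crossing beyond `(log 3)/2`" imply `EvenWinsBeyondArch`. [folklore] -/
theorem evenWinsBeyondArchOfPieces_proof :
    Summit.RiemannHypothesis.RiemannHypothesis.Theses.WeilParity.EvenWinsBeyondArchOfPieces :=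
  fun h₁ h₂ ↦
    Summit.RiemannHypothesis.RiemannHypothesis.Theorems.EvenWinsBeyondArch.evenWinsBeyondArch_of_subs h₁ h₂

end Summit.RiemannHypothesis.RiemannHypothesis.Theorems.WeilParity
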